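import Mathlib.Analysis.Convex.Jensen
import Mathlib.Analysis.SpecialFunctions.Log.Basic
import Mathlib.Algebra.Order.BigOperators.Group.Finset
import Mathlib.Algebra.BigOperators.Intervals

/-!
HONEST FRAMING: exact (Metropolis-corrected) sampling algorithms for lattice gauge theory; figures
of merit are autocorrelation/cost numbers at stated couplings and volumes; no continuum-physics
claim.

# SwapLadderMinimax — THE EQUAL-ACCEPTANCE LADDER IS MINIMAX: with an antitone pair acceptance `A(gap)`
# in a stiffness coordinate, SOME adjacent pair of every `K`-interval ladder of total length `Λ` accepts
# at most `A(Λ/K)`, the uniform ladder accepts exactly `A(Λ/K)` everywhere, the replica-count law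
# `K ≥ Λ/ℓ_p` is necessary and sufficient for all acceptances `≥ p`, and for log-concave `A` the uniform
# ladder also maximises the product of the acceptances (row 22 `su3-ptbc`, GEN-4, ours)

Venture `LatticeQCDFlow` (cell pub-lqcd), topic `Scaling`; FANOUT row 22 (`su3-ptbc`, the PTBC comparator
arm E4).  NEW WORK of the cell: the elementary optimisation facts behind the TUNING RULE OF RECORD of the
PTBC ladder (HOME `su3-ptbc/CARD-su3-ptbc.md` §1.6: "equal-acceptance re-spacing — measured pair
acceptances `p_i` ⇒ per-interval stiffness `erfcinv(p_i)` ⇒ cumulative `G(c)` ⇒ new `c` at equal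
`G`-quantiles; `N_r` needed for a uniform target `p*` is `1 + G_tot/erfcinv(p*)`"; lever
`replicas.c_tuning = equal-acceptance`, `swap_acc_target = 0.20`).  Nothing here is cited as a fact;
no special function appears (the acceptance is an abstract antitone `A : ℝ → ℝ`).

## The model, and what is proved about it

A replica ladder is read in a STIFFNESS COORDINATE `g_0 ≤ g_1 ≤ … ≤ g_K` (for PTBC: `g_i = G(c_i)`, the
cumulative defect stiffness of the card; for parallel tempering in `β`: the thermodynamic length), in which
the stationary swap acceptance of the adjacent pair `(i, i+1)` is `A(g_{i+1} − g_i)` for ONE antitone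
function `A` (in the Gaussian swap model `A(ℓ) = erfc(ℓ/(2√2))` — the tree's
`Literature.…GaussianMetropolisAcceptance.integral_min_one_exp_neg_gaussianReal_eq_erfc`; the companion
file `Scaling/SwapSpacingOptimum` treats that instance).  Writing `Λ = g_K − g_0` for the total length:

* §1 `sum_ladderGap` (the gaps telescope to `Λ`), **`exists_ladderGap_ge_div`** (pigeonhole: some gap is
  `≥ Λ/K`), **`exists_acceptance_le`** (hence SOME pair accepts at most `A(Λ/K)`, whatever the ladder),
  `le_acceptance_div_of_forall` (if every pair accepts `≥ p` then `A(Λ/K) ≥ p`).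
* §2 `uniformLadder g₀ Λ K i = g₀ + Λ·i/K`; `ladderGap_uniformLadder` (every gap is `Λ/K`);
  **`exists_acceptance_le_uniform`** — MINIMAX: against every ladder with the same endpoints, some pair of
  it accepts no better than EVERY pair of the uniform ladder (the card's equal-`G`-quantile rule is optimal
  for the worst pair, in the model); the REPLICA-COUNT LAW: for strictly antitone `A` and a level `ℓ_p`
  with `A(ℓ_p) = p`, **`length_div_le_level_of_forall_acceptance`** / **`length_div_level_le_of_forall_acceptance`**
  (all pairs `≥ p` forces `Λ/K ≤ ℓ_p`, i.e. `K ≥ Λ/ℓ_p` — NECESSITY, for every ladder) and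
  **`le_acceptance_uniformLadder`** (`K ≥ Λ/ℓ_p` makes every pair of the uniform ladder accept `≥ p` —
  SUFFICIENCY): the card's `N_r − 1 = G_tot/(2√2·erfcinv p*)` is exactly this law with
  `ℓ_p = 2√2·erfcinv(p)`.
* §3 **`sum_log_acceptance_le`**, **`prod_acceptance_le_pow`** — if `log ∘ A` is concave on a convex set
  containing the gaps (log-concave acceptance; `erfc` is log-concave), then
  `Σ_i log A(gap_i) ≤ K·log A(Λ/K)` and `Π_i A(gap_i) ≤ A(Λ/K)^K`: the uniform ladder also maximises the
  PRODUCT of the acceptances (Jensen) — the form printed by Shenfeld–Xu–Eastwood–Dror–Shaw, Phys. Rev. E 80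
  (2009) 046705 Thm 2 ("the total acceptance is maximized when the `λ_i` are equidistant" in thermodynamic
  length), NAMED ONLY; there asymptotic, here exact for the model.

Literature grade (cell rule): KNOWN MECHANISM (constant-acceptance / equidistant-in-thermodynamic-length
ladders: Kofke 2002; Rathore–Chopra–de Pablo 2005; Kone–Kofke 2005; Shenfeld et al. 2009; Katzgraber
arXiv:0905.1629), NEW TYPING as exact finite statements about an arbitrary antitone (resp. log-concave)
acceptance-of-gap function.  Relation to the tree: `Scaling/SwapAcceptanceLadder` (lean-2) proves the
rigorous two-sided law `Θ((b−a)√variance)` replicas WITHOUT a model; this file is the exact optimisation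
statement INSIDE the one-function model the card tunes with.  NOT CLAIMED: that PTBC swap acceptances ARE a
function of a stiffness gap (a measured modelling statement, CARD §9 canaries A/B/G/H: predicted to
`≤ 1 pp`); anything about round-trip times or autocorrelations; any number.
-/

noncomputable section

open Finset Real Set

namespace Summit.Ventures.LatticeQCDFlow.Scaling

/-! ## §1 Ladders in a stiffness coordinate: gaps telescope, so some gap is at least the mean gap -/

section Ladder

/-- The stiffness gap of the adjacent pair `(i, i+1)` of a ladder `g : ℕ → ℝ` (replica `i` sits at
stiffness coordinate `g i`). [ours] -/
def ladderGap (g : ℕ → ℝ) (i : ℕ) : ℝ := g (i + 1) - g i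

/-- The gap of pair `i`, unfolded. [ours] -/
theorem ladderGap_apply (g : ℕ → ℝ) (i : ℕ) : ladderGap g i = g (i + 1) - g i := rfl

/-- The gaps of a `K`-interval ladder telescope to its total length `Λ = g K − g 0`. [folklore] -/
theorem sum_ladderGap (g : ℕ → ℝ) (K : ℕ) : ∑ i ∈ range K, ladderGap g i = g K - g 0 :=
  Finset.sum_range_sub g K

/-- **Pigeonhole**: some gap of a `K`-interval ladder (`K ≥ 1`) is at least the mean gap `Λ/K`.
[folklore] -/
theorem exists_ladderGap_ge_div {K : ℕ} (hK : 0 < K) (g : ℕ → ℝ) :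
    ∃ i ∈ range K, (g K - g 0) / K ≤ ladderGap g i := by
  have hne : (range K).Nonempty := Finset.nonempty_range_iff.mpr hK.ne'
  refine Finset.exists_le_of_sum_le hne ?_
  rw [sum_const, card_range, sum_ladderGap, nsmul_eq_mul]
  have hK' : (K : ℝ) ≠ 0 := by exact_mod_cast hK.ne'
  rw [mul_div_cancel₀ _ hK']

/-- **Some pair accepts at most `A(Λ/K)`.**  If the pair acceptance is an antitone function `A` of the
stiffness gap, then in EVERY `K`-interval ladder of total length `Λ` some adjacent pair has acceptance
`≤ A(Λ/K)`. [ours] -/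
theorem exists_acceptance_le {K : ℕ} (hK : 0 < K) (g : ℕ → ℝ) {A : ℝ → ℝ} (hA : Antitone A) :
    ∃ i ∈ range K, A (ladderGap g i) ≤ A ((g K - g 0) / K) := by
  obtain ⟨i, hi, h⟩ := exists_ladderGap_ge_div hK g
  exact ⟨i, hi, hA h⟩

/-- Necessity form: if EVERY adjacent pair of a `K`-interval ladder of length `Λ` accepts with probability
`≥ p`, then `p ≤ A(Λ/K)`. [ours] -/
theorem le_acceptance_div_of_forall {K : ℕ} (hK : 0 < K) (g : ℕ → ℝ) {A : ℝ → ℝ} (hA : Antitone A)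
    {p : ℝ} (hp : ∀ i ∈ range K, p ≤ A (ladderGap g i)) : p ≤ A ((g K - g 0) / K) := by
  obtain ⟨i, hi, h⟩ := exists_acceptance_le hK g hA
  exact (hp i hi).trans h

end Ladder

/-! ## §2 The uniform ladder attains the bound: minimax optimality and the replica-count law -/

section Uniform

/-- **The uniform (equal-stiffness) ladder** from `g₀` of total length `Λ` with `K` intervals:
`g_i = g₀ + Λ·i/K` — the card's "new `c` at equal `G`-quantiles", read in the coordinate `g = G(c)`.
(For `K = 0` Lean's `x/0 = 0` makes it the constant ladder; every statement below has `K ≥ 1` where it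
matters.) [ours] -/
def uniformLadder (g₀ Λ : ℝ) (K : ℕ) (i : ℕ) : ℝ := g₀ + Λ * i / K

/-- The uniform ladder starts at `g₀`. [ours] -/
theorem uniformLadder_zero (g₀ Λ : ℝ) (K : ℕ) : uniformLadder g₀ Λ K 0 = g₀ := by
  simp [uniformLadder]

/-- The uniform ladder with `K ≥ 1` intervals ends at `g₀ + Λ`. [ours] -/
theorem uniformLadder_top (g₀ Λ : ℝ) {K : ℕ} (hK : 0 < K) : uniformLadder g₀ Λ K K = g₀ + Λ := by
  have hK' : (K : ℝ) ≠ 0 := by exact_mod_cast hK.ne'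
  rw [uniformLadder, mul_div_cancel_right₀ _ hK']

/-- Its total length is `Λ`. [ours] -/
theorem uniformLadder_length (g₀ Λ : ℝ) {K : ℕ} (hK : 0 < K) :
    uniformLadder g₀ Λ K K - uniformLadder g₀ Λ K 0 = Λ := by
  rw [uniformLadder_top g₀ Λ hK, uniformLadder_zero]
  ring

/-- **Every gap of the uniform ladder is the mean gap `Λ/K`.** [ours] -/
theorem ladderGap_uniformLadder (g₀ Λ : ℝ) (K i : ℕ) : ladderGap (uniformLadder g₀ Λ K) i = Λ / K := by
  simp only [ladderGap, uniformLadder]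
  push_cast
  ring

/-- The uniform ladder is monotone when `Λ ≥ 0`. [ours] -/
theorem monotone_uniformLadder (g₀ : ℝ) {Λ : ℝ} (hΛ : 0 ≤ Λ) (K : ℕ) : Monotone (uniformLadder g₀ Λ K) := by
  intro i j hij
  simp only [uniformLadder]
  have : (i : ℝ) ≤ j := by exact_mod_cast hij
  have hK : (0 : ℝ) ≤ K := Nat.cast_nonneg K
  gcongr

/-- Every adjacent pair of the uniform ladder accepts with the same probability `A(Λ/K)`. [ours] -/
theorem acceptance_uniformLadder (g₀ Λ : ℝ) (K : ℕ) (A : ℝ → ℝ) (i : ℕ) :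
    A (ladderGap (uniformLadder g₀ Λ K) i) = A (Λ / K) := by
  rw [ladderGap_uniformLadder]

/-- **MINIMAX OPTIMALITY OF THE EQUAL-ACCEPTANCE LADDER.**  For an antitone acceptance-of-gap function
`A`, every `K`-interval ladder `g` (`K ≥ 1`) has SOME adjacent pair whose acceptance is at most the
(common) acceptance of EVERY pair `j` of the uniform ladder with the same endpoints `g 0`, `g K`: no ladder
has a better worst pair than the uniform one. [ours] -/
theorem exists_acceptance_le_uniform {K : ℕ} (hK : 0 < K) (g : ℕ → ℝ) {A : ℝ → ℝ} (hA : Antitone A)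
    (j : ℕ) :
    ∃ i ∈ range K, A (ladderGap g i) ≤ A (ladderGap (uniformLadder (g 0) (g K - g 0) K) j) := by
  rw [ladderGap_uniformLadder]
  exact exists_acceptance_le hK g hA

/-- **REPLICA-COUNT LAW, NECESSITY.**  Let `A` be strictly antitone and `ℓ_p` a gap with `A(ℓ_p) = p`
(the `p`-level of `A`; in the Gaussian model `ℓ_p = 2√2·erfcinv p`).  If every adjacent pair of a
`K`-interval ladder of length `Λ` accepts `≥ p`, then `Λ/K ≤ ℓ_p`. [ours] -/
theorem length_div_le_level_of_forall_acceptance {K : ℕ} (hK : 0 < K) (g : ℕ → ℝ) {A : ℝ → ℝ}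
    (hA : StrictAnti A) {p ℓp : ℝ} (hℓ : A ℓp = p)
    (hp : ∀ i ∈ range K, p ≤ A (ladderGap g i)) : (g K - g 0) / K ≤ ℓp := by
  have h := le_acceptance_div_of_forall hK g hA.antitone hp
  rw [← hℓ] at h
  by_contra hlt
  exact absurd h (not_le.mpr (hA (not_le.mp hlt)))

/-- **REPLICA-COUNT LAW, NECESSITY (count form).**  Under the same hypotheses with `ℓ_p > 0`:
`K ≥ Λ/ℓ_p` — the card's "`N_r − 1 = G_tot/(2√2·erfcinv p*)` intervals are needed". [ours] -/
theorem length_div_level_le_of_forall_acceptance {K : ℕ} (hK : 0 < K) (g : ℕ → ℝ) {A : ℝ → ℝ}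
    (hA : StrictAnti A) {p ℓp : ℝ} (hℓ : A ℓp = p) (hℓp : 0 < ℓp)
    (hp : ∀ i ∈ range K, p ≤ A (ladderGap g i)) : (g K - g 0) / ℓp ≤ K := by
  have h := length_div_le_level_of_forall_acceptance hK g hA hℓ hp
  have hK' : (0 : ℝ) < K := by exact_mod_cast hK
  rw [div_le_iff₀ hℓp]
  rw [div_le_iff₀ hK'] at h
  linarith [mul_comm ℓp (K : ℝ)]

/-- **REPLICA-COUNT LAW, SUFFICIENCY.**  For an antitone `A` with `A(ℓ_p) = p`, `ℓ_p > 0`: if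
`K ≥ Λ/ℓ_p` (and `K ≥ 1`) then EVERY adjacent pair of the uniform `K`-interval ladder of length `Λ`
accepts with probability `≥ p`. [ours] -/
theorem le_acceptance_uniformLadder {K : ℕ} (hK : 0 < K) {A : ℝ → ℝ} (hA : Antitone A) {p ℓp : ℝ}
    (hℓ : A ℓp = p) (hℓp : 0 < ℓp) {g₀ Λ : ℝ} (hKΛ : Λ / ℓp ≤ K) (i : ℕ) :
    p ≤ A (ladderGap (uniformLadder g₀ Λ K) i) := by
  rw [ladderGap_uniformLadder, ← hℓ]
  apply hA
  have hK' : (0 : ℝ) < K := by exact_mod_cast hK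
  rw [div_le_iff₀ hK']
  rw [div_le_iff₀ hℓp] at hKΛ
  linarith [mul_comm ℓp (K : ℝ)]

/-- The two directions together: with a strictly antitone `A`, `A(ℓ_p) = p`, `ℓ_p > 0`, a `K`-interval
uniform ladder of length `Λ` has all adjacent acceptances `≥ p` IFF `Λ/ℓ_p ≤ K`; and by
`length_div_level_le_of_forall_acceptance` no other ladder does better. [ours] -/
theorem forall_acceptance_uniformLadder_iff {K : ℕ} (hK : 0 < K) {A : ℝ → ℝ} (hA : StrictAnti A)
    {p ℓp : ℝ} (hℓ : A ℓp = p) (hℓp : 0 < ℓp) (g₀ Λ : ℝ) :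
    (∀ i ∈ range K, p ≤ A (ladderGap (uniformLadder g₀ Λ K) i)) ↔ Λ / ℓp ≤ K := by
  constructor
  · intro h
    have := length_div_level_le_of_forall_acceptance hK (uniformLadder g₀ Λ K) hA hℓ hℓp h
    rwa [uniformLadder_length g₀ Λ hK] at this
  · intro h i _
    exact le_acceptance_uniformLadder hK hA.antitone hℓ hℓp h i

end Uniform

/-! ## §3 Log-concave acceptance: the uniform ladder also maximises the product of the acceptances -/

section Product

/-- The mean gap `Λ/K` of a ladder whose gaps lie in a convex set `I` lies in `I`. [folklore] -/
theorem length_div_mem_of_gaps_mem {K : ℕ} (hK : 0 < K) (g : ℕ → ℝ) {I : Set ℝ} (hI : Convex ℝ I)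
    (hg : ∀ i ∈ range K, ladderGap g i ∈ I) : (g K - g 0) / K ∈ I := by
  have hK' : (K : ℝ) ≠ 0 := by exact_mod_cast hK.ne'
  have hw : ∑ i ∈ range K, (1 / (K : ℝ)) = 1 := by
    rw [sum_const, card_range, nsmul_eq_mul]
    field_simp
  have hmem := hI.sum_mem (t := range K) (w := fun _ => 1 / (K : ℝ)) (z := fun i => ladderGap g i)
    (fun _ _ => by positivity) hw hg
  have hsum : ∑ i ∈ range K, (1 / (K : ℝ)) • ladderGap g i = (g K - g 0) / K := by
    rw [← Finset.smul_sum, sum_ladderGap, smul_eq_mul]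
    ring
  rwa [hsum] at hmem

/-- **Jensen for a log-concave acceptance.**  If `log ∘ A` is concave on a convex set `I` containing every
gap of a `K`-interval ladder (`K ≥ 1`) of length `Λ`, then `Σ_i log A(gap_i) ≤ K · log A(Λ/K)`. [ours] -/
theorem sum_log_acceptance_le {K : ℕ} (hK : 0 < K) (g : ℕ → ℝ) {A : ℝ → ℝ} {I : Set ℝ}
    (hlogA : ConcaveOn ℝ I (fun x => Real.log (A x))) (hg : ∀ i ∈ range K, ladderGap g i ∈ I) :
    ∑ i ∈ range K, Real.log (A (ladderGap g i)) ≤ K * Real.log (A ((g K - g 0) / K)) := by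
  have hK' : (K : ℝ) ≠ 0 := by exact_mod_cast hK.ne'
  have hKpos : (0 : ℝ) < K := by exact_mod_cast hK
  have hw : ∑ i ∈ range K, (1 / (K : ℝ)) = 1 := by
    rw [sum_const, card_range, nsmul_eq_mul]
    field_simp
  have hJ := hlogA.le_map_sum (t := range K) (w := fun _ => 1 / (K : ℝ)) (p := fun i => ladderGap g i)
    (fun _ _ => by positivity) hw hg
  have hsum : ∑ i ∈ range K, (1 / (K : ℝ)) • ladderGap g i = (g K - g 0) / K := by
    rw [← Finset.smul_sum, sum_ladderGap, smul_eq_mul]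
    ring
  rw [hsum, ← Finset.smul_sum, smul_eq_mul] at hJ
  -- `hJ : (1/K) * Σ log A(gap) ≤ log A(Λ/K)`; multiply by `K > 0`
  have := mul_le_mul_of_nonneg_left hJ hKpos.le
  rwa [← mul_assoc, mul_one_div_cancel hK', one_mul] at this

/-- **The uniform ladder maximises the product of the acceptances** (log-concave `A`, positive on `I`):
`Π_i A(gap_i) ≤ A(Λ/K)^K`, the right side being the product over the uniform ladder with the same
endpoints (`acceptance_uniformLadder`).  Shenfeld et al. 2009 Thm 2, NAMED ONLY (there to second order in
the spacing; here exact in the model). [ours] -/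
theorem prod_acceptance_le_pow {K : ℕ} (hK : 0 < K) (g : ℕ → ℝ) {A : ℝ → ℝ} {I : Set ℝ}
    (hI : Convex ℝ I) (hApos : ∀ x ∈ I, 0 < A x)
    (hlogA : ConcaveOn ℝ I (fun x => Real.log (A x))) (hg : ∀ i ∈ range K, ladderGap g i ∈ I) :
    ∏ i ∈ range K, A (ladderGap g i) ≤ A ((g K - g 0) / K) ^ K := by
  have hprodpos : 0 < ∏ i ∈ range K, A (ladderGap g i) :=
    Finset.prod_pos fun i hi => hApos _ (hg i hi)
  have havgpos : 0 < A ((g K - g 0) / K) := hApos _ (length_div_mem_of_gaps_mem hK g hI hg)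
  rw [← Real.exp_log hprodpos, ← Real.exp_log (pow_pos havgpos K), Real.exp_le_exp, Real.log_prod,
    Real.log_pow]
  · exact sum_log_acceptance_le hK g hlogA hg
  · intro i hi
    exact (hApos _ (hg i hi)).ne'

/-- The bound of `prod_acceptance_le_pow` is attained by the uniform ladder. [ours] -/
theorem prod_acceptance_uniformLadder (g₀ Λ : ℝ) (K : ℕ) (A : ℝ → ℝ) :
    ∏ i ∈ range K, A (ladderGap (uniformLadder g₀ Λ K) i) = A (Λ / K) ^ K := by
  simp [ladderGap_uniformLadder]

end Product


/-! ## (Appended, GEN-4) The uniform ladder is the UNIQUE minimax ladder for a strictly antitone acceptance -/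

section Unique

/-- **If the gaps of a `K`-interval ladder are not all equal to the mean gap, some gap EXCEEDS the mean**
(they sum to `Λ`). [folklore] -/
theorem exists_ladderGap_gt_div {K : ℕ} (hK : 0 < K) (g : ℕ → ℝ)
    (hne : ∃ i ∈ range K, ladderGap g i ≠ (g K - g 0) / K) :
    ∃ i ∈ range K, (g K - g 0) / K < ladderGap g i := by
  by_contra hcon
  push Not at hcon
  obtain ⟨j, hj, hjne⟩ := hne
  have hjlt : ladderGap g j < (g K - g 0) / K := lt_of_le_of_ne (hcon j hj) hjne
  have hK' : (K : ℝ) ≠ 0 := by exact_mod_cast hK.ne'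
  -- summing the strict inequality at `j` and the weak ones elsewhere contradicts `Σ gaps = Λ`
  have hlt : ∑ i ∈ range K, ladderGap g i < ∑ i ∈ range K, (g K - g 0) / K :=
    Finset.sum_lt_sum hcon ⟨j, hj, hjlt⟩
  rw [sum_ladderGap, sum_const, card_range, nsmul_eq_mul, mul_div_cancel₀ _ hK'] at hlt
  exact lt_irrefl _ hlt

/-- **UNIQUENESS OF THE MINIMAX LADDER.**  For a STRICTLY antitone acceptance-of-gap function, every
`K`-interval ladder of total length `Λ` other than the uniform one (some gap `≠ Λ/K`) has a pair accepting
STRICTLY less than `A(Λ/K)`, the common acceptance of the uniform ladder: equal spacing in the stiffness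
coordinate is the only ladder whose worst pair attains the optimum. [ours] -/
theorem exists_acceptance_lt_of_ne_uniform {K : ℕ} (hK : 0 < K) (g : ℕ → ℝ) {A : ℝ → ℝ}
    (hA : StrictAnti A) (hne : ∃ i ∈ range K, ladderGap g i ≠ (g K - g 0) / K) :
    ∃ i ∈ range K, A (ladderGap g i) < A ((g K - g 0) / K) := by
  obtain ⟨i, hi, hlt⟩ := exists_ladderGap_gt_div hK g hne
  exact ⟨i, hi, hA hlt⟩

/-- Equivalently: if EVERY pair of a ladder accepts at least `A(Λ/K)` (the uniform ladder's value), the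
ladder IS uniform — all gaps equal `Λ/K`. [ours] -/
theorem ladderGap_eq_div_of_forall_acceptance_ge {K : ℕ} (hK : 0 < K) (g : ℕ → ℝ) {A : ℝ → ℝ}
    (hA : StrictAnti A) (h : ∀ i ∈ range K, A ((g K - g 0) / K) ≤ A (ladderGap g i)) :
    ∀ i ∈ range K, ladderGap g i = (g K - g 0) / K := by
  by_contra hcon
  push Not at hcon
  obtain ⟨i, hi, hlt⟩ := exists_acceptance_lt_of_ne_uniform hK g hA hcon
  exact absurd (h i hi) (not_le.mpr hlt)

end Unique

/-! ## §5 (Appended, GEN-6) Convex per-gap COST: the uniform ladder minimises the total cost `Σ_i C(gap_i)`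
(Jensen), uniquely for a strictly convex `C` — the dual of §3 (log-concave acceptance ⇒ maximal product);
instance: `C = 1/A` = the per-bond round-trip weight of `SwapLadderDeliveryTime` / GEN-5's round-trip files -/

section ConvexCost

/-- **Jensen for a convex pair cost**: if `C` is convex on a convex set containing every gap of a
`K`-interval ladder (`K ≥ 1`) of length `Λ = g K − g 0`, then `K·C(Λ/K) ≤ Σ_i C(gap_i)` — the uniform
ladder (every gap `Λ/K`, §2) minimises the total per-gap cost. [ours] -/
theorem mul_cost_div_le_sum_cost {K : ℕ} (hK : 0 < K) (g : ℕ → ℝ) {C : ℝ → ℝ} {I : Set ℝ}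
    (hC : ConvexOn ℝ I C) (hg : ∀ i ∈ range K, ladderGap g i ∈ I) :
    (K : ℝ) * C ((g K - g 0) / K) ≤ ∑ i ∈ range K, C (ladderGap g i) := by
  have hK' : (K : ℝ) ≠ 0 := by exact_mod_cast hK.ne'
  have hKpos : (0 : ℝ) < K := by exact_mod_cast hK
  have hw : ∑ _i ∈ range K, (1 / (K : ℝ)) = 1 := by
    rw [sum_const, card_range, nsmul_eq_mul]; field_simp
  have hJ := hC.map_sum_le (t := range K) (w := fun _ => 1 / (K : ℝ)) (p := fun i => ladderGap g i)
    (fun _ _ => by positivity) hw hg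
  have hsum : ∑ i ∈ range K, (1 / (K : ℝ)) • ladderGap g i = (g K - g 0) / K := by
    rw [← Finset.smul_sum, sum_ladderGap, smul_eq_mul]; ring
  rw [hsum, ← Finset.smul_sum, smul_eq_mul] at hJ
  have := mul_le_mul_of_nonneg_left hJ hKpos.le
  rwa [← mul_assoc, mul_one_div_cancel hK', one_mul] at this

/-- **Strict Jensen**: for a STRICTLY convex pair cost and a ladder with some gap `≠ Λ/K`,
`K·C(Λ/K) < Σ_i C(gap_i)` — the uniform ladder is the UNIQUE minimiser of the total cost. [ours] -/
theorem mul_cost_div_lt_sum_cost {K : ℕ} (hK : 0 < K) (g : ℕ → ℝ) {C : ℝ → ℝ} {I : Set ℝ}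
    (hC : StrictConvexOn ℝ I C) (hg : ∀ i ∈ range K, ladderGap g i ∈ I)
    (hne : ∃ i ∈ range K, ladderGap g i ≠ (g K - g 0) / K) :
    (K : ℝ) * C ((g K - g 0) / K) < ∑ i ∈ range K, C (ladderGap g i) := by
  have hK' : (K : ℝ) ≠ 0 := by exact_mod_cast hK.ne'
  have hKpos : (0 : ℝ) < K := by exact_mod_cast hK
  have hw : ∑ _i ∈ range K, (1 / (K : ℝ)) = 1 := by
    rw [sum_const, card_range, nsmul_eq_mul]; field_simp
  have hsum : ∑ i ∈ range K, (1 / (K : ℝ)) • ladderGap g i = (g K - g 0) / K := by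
    rw [← Finset.smul_sum, sum_ladderGap, smul_eq_mul]; ring
  have hne' : ∃ j ∈ range K, ladderGap g j ≠ ∑ i ∈ range K, (1 / (K : ℝ)) • ladderGap g i := by
    rw [hsum]; exact hne
  have hJ := (hC.map_sum_lt_iff_of_pos' (t := range K) (w := fun _ => 1 / (K : ℝ))
    (p := fun i => ladderGap g i) (fun _ _ => by positivity) hw hg).mpr hne'
  rw [hsum, ← Finset.smul_sum, smul_eq_mul] at hJ
  have := mul_lt_mul_of_pos_left hJ hKpos
  rwa [← mul_assoc, mul_one_div_cancel hK', one_mul] at this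

/-- The total cost of the uniform ladder is `K·C(Λ/K)` (the bound of `mul_cost_div_le_sum_cost` is attained).
[ours] -/
theorem sum_cost_uniformLadder (g₀ Λ : ℝ) (K : ℕ) (C : ℝ → ℝ) :
    ∑ i ∈ range K, C (ladderGap (uniformLadder g₀ Λ K) i) = (K : ℝ) * C (Λ / K) := by
  simp [ladderGap_uniformLadder]

/-- **Uniqueness form**: under a strictly convex cost, a ladder whose total cost does not exceed the uniform
value has every gap equal to `Λ/K`. [ours] -/
theorem ladderGap_eq_div_of_sum_cost_le {K : ℕ} (hK : 0 < K) (g : ℕ → ℝ) {C : ℝ → ℝ} {I : Set ℝ}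
    (hC : StrictConvexOn ℝ I C) (hg : ∀ i ∈ range K, ladderGap g i ∈ I)
    (h : ∑ i ∈ range K, C (ladderGap g i) ≤ (K : ℝ) * C ((g K - g 0) / K)) :
    ∀ i ∈ range K, ladderGap g i = (g K - g 0) / K := by
  by_contra hcon
  push Not at hcon
  exact absurd h (not_le.mpr (mul_cost_div_lt_sum_cost hK g hC hg hcon))

end ConvexCost

end Summit.Ventures.LatticeQCDFlow.Scaling

end
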